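import Summits.ResolutionOfSingularities.ResolutionOfSingularities.Theorems.EquisingularLiftEquisingularLiftNatTowerReachTwoDefs
import HarnessLib

/-!
# Route `EquisingularLift`, crux EL♮(3) (stmt-ResolutionOfSingularities-20148) / EL♮ (stmt-…-20038) — revision ₁/₂ bookkeeping: the FORGOTTEN SHADOW `K = ∅`
# propagates and never fires a cone witness (boilerplate for the HSUB′(ReachTower₂)₃ driver's `K = ∅` branch)

res-L1-w45b-lead-2 g2 (lead). OURS; pure logic / point-set bookkeeping over …NatTowerDefs (p541504), …NatTowerConeDefs (p552864),
…NatTowerReachTwoDefs (p556233); AI-written.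
* `closure_preimage_empty_diff` — `closure (υ⁻¹' (∅ ∖ S)) = ∅`;
* `ConeWitness.eq_empty` / `not_coneWitness_empty` — a cone witness against the shadow `∅` forces an empty centre, so `Z.Nonempty` excludes it;
* `shadow_menu_empty` — from `K = ∅`, every entry of the `₁`/`₂` shadow menus `K' = ∅ ∨ (side ∧ K' = closure (υ⁻¹' (K ∖ S)))` is `K' = ∅`;
* `towerRound₁_adm_of_empty` — with shadow `∅` the round's admission disjunction reduces to its Čech (rational-carrier) disjunct.
-/

set_option linter.dupNamespace false

noncomputable section

open CategoryTheory AlgebraicGeometry TopologicalSpace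

namespace Summit.ResolutionOfSingularities.ResolutionOfSingularities.Cruxes.EquisingularLiftNat.Sections

/-- Transporting the empty shadow gives the empty shadow. [OURS · point-set] -/
theorem closure_preimage_empty_diff {G G' : Scheme.{0}} (υ : G' ⟶ G) (S : Set G) :
    closure (υ ⁻¹' ((∅ : Set G) \ S)) = (∅ : Set G') := by
  simp

/-- A cone witness against the empty shadow has empty centre. [OURS · point-set] -/
theorem ConeWitness.eq_empty {G : Scheme.{0}} {E : Set G} {hE : IsClosed E} {Z : Set G} {hZ : IsClosed Z}
    (h : ConeWitness G E hE ∅ Z hZ) : Z = ∅ := by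
  obtain ⟨hZ', -⟩ := h
  simpa using hZ'

/-- No cone witness fires against the empty shadow at a non-empty centre. [OURS · point-set] -/
theorem not_coneWitness_empty {G : Scheme.{0}} {E : Set G} {hE : IsClosed E} {Z : Set G} {hZ : IsClosed Z}
    (hne : Z.Nonempty) : ¬ ConeWitness G E hE ∅ Z hZ := fun h => by
  rw [ConeWitness.eq_empty h] at hne
  exact Set.not_nonempty_empty hne

/-- From the empty shadow every entry of the `₁`/`₂` shadow menu is the empty shadow. [OURS · point-set] -/
theorem shadow_menu_empty {G G' : Scheme.{0}} (υ : G' ⟶ G) (S : Set G) {side : Prop} {K' : Set G'}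
    (h : K' = ∅ ∨ (side ∧ K' = closure (υ ⁻¹' ((∅ : Set G) \ S)))) : K' = ∅ := by
  rcases h with h | ⟨-, h⟩
  · exact h
  · rw [h, closure_preimage_empty_diff]

/-- With the empty shadow, `TowerRound₁`'s admission disjunction is its Čech disjunct. [OURS · pure logic] -/
theorem towerRound₁_adm_of_empty {F₉ : Scheme.{0}} {Z₉ : Set F₉} {hZ₉ : IsClosed Z₉} {G : Scheme.{0}} {E : Set G} {hE : IsClosed E}
    {Z : Set G} {hZ : IsClosed Z} (hne : Z.Nonempty)
    (hadm : (RationalCarrier (redSub F₉ Z₉ hZ₉) ∧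
        (∀ x : redSub G Z hZ, IsRegularLocalRing (G.presheaf.stalk (redSubι G Z hZ x))) ∧
        (∀ (i : redSub G Z hZ ⟶ redSub G E hE), i ≫ redSubι G E hE = redSubι G Z hZ →
          ∀ x : redSub G Z hZ, IsRegularLocalRing ((redSub G E hE).presheaf.stalk (i x))) ∧
        DirStepUnobs G E hE Z hZ) ∨
      ConeWitness G E hE ∅ Z hZ) :
    RationalCarrier (redSub F₉ Z₉ hZ₉) ∧
      (∀ x : redSub G Z hZ, IsRegularLocalRing (G.presheaf.stalk (redSubι G Z hZ x))) ∧
      (∀ (i : redSub G Z hZ ⟶ redSub G E hE), i ≫ redSubι G E hE = redSubι G Z hZ →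
        ∀ x : redSub G Z hZ, IsRegularLocalRing ((redSub G E hE).presheaf.stalk (i x))) ∧
      DirStepUnobs G E hE Z hZ := by
  rcases hadm with h | h
  · exact h
  · exact absurd h (not_coneWitness_empty hne)

end Summit.ResolutionOfSingularities.ResolutionOfSingularities.Cruxes.EquisingularLiftNat.Sections

namespace Summit.ResolutionOfSingularities.ResolutionOfSingularities.Cruxes.EquisingularLiftNat.Sections

open CategoryTheory AlgebraicGeometry TopologicalSpace in
/-- **The empty seed shadow stays empty through the in-carrier point closure**: `InCarrierReachK F₂ T₂ Z₂ ∅ … K₉ b₉ → K₉ = ∅`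
(induction over the closure with the predicate «K = ∅»). [OURS · pure logic] -/
theorem inCarrierReachK_empty {F₂ : Scheme.{0}} {T₂ Z₂ : Set F₂} {F₉ : Scheme.{0}} {β₉ : F₉ ⟶ F₂} {T₉ Z₉ K₉ : Set F₉}
    {b₉ : Bool} (h : InCarrierReachK F₂ T₂ Z₂ ∅ F₉ β₉ T₉ Z₉ K₉ b₉) : K₉ = ∅ := by
  refine h (fun G _ _ _ K _ => K = ∅) rfl ?_ ?_
  · intro G₁ G₂ β T Z K b y υ₁ hy hK _ _ _ _
    subst hK; simp
  · intro G₁ G₂ β T Z K y υ₁ hy hK _ _ _ _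
    subst hK; simp

end Summit.ResolutionOfSingularities.ResolutionOfSingularities.Cruxes.EquisingularLiftNat.Sections

end
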